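import Summits.AtomisticToContinuum.HydrodynamicLimit.Theorems.AntiMazurCoboundariesInfluenceLocalityAnchoredCoveringLineage
import Summits.AtomisticToContinuum.HydrodynamicLimit.Theorems.AntiMazurCoboundariesInfluenceLocalityAnchoredCoveringNullSets

/-!
# Stub `stub_anchoredCovering` of the line `true-anchored-infection` (crux `InfluenceLocality`,
# stmt-AtomisticToContinuum-13916): the anchored covering

The registered stub STUB 3 `AnchoredCovering` of the objects module
`AntiMazurCoboundariesInfluenceLocalityObjects`: for `G_N`-a.e. datum `z` and every particle `i`,
if `i` is bad at range `R` on `[0, Tℓ]`, no true particle is `u`-hot in the halo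
`B(x_i(0), (R + D)ℓ)` and no forecast particle of `i` is `w`-hot (`u ≤ w`), then a tight
anchored chain of `K` links of absolute speed `w + ‖u₀‖` ends at `i`, whenever
`(K + 2)σ + (u + w + 2‖u₀‖)T ≤ R` and `D ≥ (u + ‖u₀‖)T + 2σ`.

* `mem_of_grid` — a closed one-particle condition holding at the rational grid times `Tℓ q`,
  `q ∈ ℚ ∩ [0, 1]`, whenever an open condition holds there, holds at every real time of `[0, Tℓ]`
  at which the open condition holds (right-continuity of trajectories, density of `ℚ`): the caps
  `¬ IsHot`, `¬ IsForecastHot` at grid times are caps at all times;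
* `exists_grid_rounding` — rounding finitely many increasing times of `[0, L]` UP to rational
  grid times `L q`, keeping the order, each so close that a given continuous position moves by
  `≤ δ` and `W ·` the time shift is `≤ δ`; `isTightChain_of_rawChain` — hence an anchored
  chain through true space-time points at REAL times with steps `≤ ε + W Δt` is a tight chain
  (`IsTightChain`, grid times, slack `ε / (K + 1)` per link);
* `exists_rawChain_of_good` — on the good set (`z ∈ Φ.good` and the range cluster of `i`
  restricts to a good datum of its cluster flow) the true orbit and the forecast world of `i`
  form a `CoveringSetting` (prelim `…AnchoredCoveringLineage`), and the first-infection lineage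
  of `K` links hanging from `i` (`CoveringSetting.exists_lineage`), read backwards, is such a
  raw chain: its anchors are TRUE space-time points;
* `anchoredCovering_of_good`, and the registered **`stub_anchoredCovering : AnchoredCovering`**
  (`G_N ≪ Liouville`; the null sets `Φ.goodᶜ` and, for each of the finitely many `S`,
  `{z | restrictTo S z ∉ (Ψ |S|).good}` of prelim `…AnchoredCoveringNullSets`).
-/

namespace Summit.AtomisticToContinuum.HydrodynamicLimit.Theorems.TrueAnchoredInfection

open MeasureTheory Set Filter Topology Function
open scoped ENNReal
open Literature.Analysis Literature.Analysis.FluidPDE Literature.MathematicalPhysics.KineticTheory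

noncomputable section

/-! ## From grid times to all times -/

section Grid

variable {d : Type*} [Fintype d] {ε : ℝ} {N : ℕ} {γ : ℝ → Config N d (UnitAddTorus d)}

/-- **From grid times to all times.** Let `O` be open and `C` closed in one-particle phase space.
If at every grid time `L q`, `q ∈ ℚ ∩ [0, 1]`, at which the state of `j` lies in `O` it also lies
in `C`, then the same holds at every real time of `[0, L]` (trajectories are right-continuous and
grid times accumulate at every `t < L` from the right). -/
theorem mem_of_grid (h : IsHardSphereTrajectory (Torus.geometry d) ε N γ) (j : Fin N) {L : ℝ}
    {O C : Set (UnitAddTorus d × EuclideanSpace ℝ d)} (hO : IsOpen O) (hC : IsClosed C)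
    (hgrid : ∀ q : ℚ, 0 ≤ q → q ≤ 1 → γ (L * q) j ∈ O → γ (L * q) j ∈ C) :
    ∀ t ∈ Icc 0 L, γ t j ∈ O → γ t j ∈ C := by
  intro t ht htO
  rcases ht.2.eq_or_lt with rfl | htL
  · have h1 := hgrid 1 zero_le_one le_rfl
    simp only [Rat.cast_one, mul_one] at h1
    exact h1 htO
  · have hL0 : 0 < L := ht.1.trans_lt htL
    have hcont : Tendsto (fun s => γ s j) (𝓝[>] t) (𝓝 (γ t j)) :=
      ((continuous_apply j).tendsto _).comp (h.tendsto_nhdsGT Torus.continuous_geometry_translate t)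
    refine hC.mem_of_frequently_of_tendsto ?_ hcont
    have hevO : ∀ᶠ s in 𝓝[>] t, γ s j ∈ O := hcont (hO.mem_nhds htO)
    have hfreq : ∃ᶠ s in 𝓝[>] t, ∃ q : ℚ, 0 ≤ q ∧ q ≤ 1 ∧ (L * q : ℝ) = s := by
      rw [(nhdsGT_basis t).frequently_iff]
      intro b hb
      have hlt : t / L < min b L / L := div_lt_div_of_pos_right (lt_min hb htL) hL0
      obtain ⟨q, hq1, hq2⟩ := exists_rat_btwn hlt
      have hq0 : (0 : ℝ) ≤ q := ((div_nonneg ht.1 hL0.le).trans_lt hq1).le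
      have hq1' : (q : ℝ) ≤ 1 :=
        (hq2.trans_le ((div_le_one hL0).2 (min_le_right _ _))).le
      refine ⟨L * q, ⟨?_, ?_⟩, q, by exact_mod_cast hq0, by exact_mod_cast hq1', rfl⟩
      · have := mul_lt_mul_of_pos_left hq1 hL0
        rwa [mul_div_cancel₀ _ hL0.ne'] at this
      · have := mul_lt_mul_of_pos_left hq2 hL0
        rw [mul_div_cancel₀ _ hL0.ne'] at this
        exact this.trans_le (min_le_left _ _)
    refine (hfreq.and_eventually hevO).mono ?_
    rintro s ⟨⟨q, hq0, hq1, rfl⟩, hsO⟩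
    exact hgrid q hq0 hq1 hsO

end Grid

/-! ## Rounding up to rational grid times -/

/-- **Rational rounding.** Strictly increasing times `t s ∈ [0, L]` (`0 < L`) can be rounded UP
to grid times `L q_s`, `q_s ∈ ℚ ∩ [0, 1]` strictly increasing, so close that `W (L q_s - t s) ≤ δ`
and the continuous curve `X s` moves by at most `δ` between `t s` and `L q_s`. -/
theorem exists_grid_rounding {d : Type*} [Fintype d] {K : ℕ} {L δ W : ℝ} (hL : 0 < L)
    (hδ : 0 < δ) {t : Fin (K + 1) → ℝ} (ht : StrictMono t) (ht0 : ∀ s, 0 ≤ t s)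
    (htL : ∀ s, t s ≤ L) {X : Fin (K + 1) → ℝ → UnitAddTorus d} (hX : ∀ s, Continuous (X s)) :
    ∃ q : Fin (K + 1) → ℚ, StrictMono q ∧ (∀ s, 0 ≤ q s ∧ q s ≤ 1) ∧
      ∀ s, t s ≤ L * q s ∧ W * (L * q s - t s) ≤ δ ∧
        Torus.euclidDist (X s (L * q s)) (X s (t s)) ≤ δ := by
  have key : ∀ s, ∃ q : ℚ, (0 ≤ q ∧ q ≤ 1) ∧ t s ≤ L * q ∧ (∀ s', t s < t s' → L * q < t s') ∧
      W * (L * q - t s) ≤ δ ∧ Torus.euclidDist (X s (L * q)) (X s (t s)) ≤ δ := by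
    intro s
    set r₀ : ℝ := t s / L with hr₀
    have hLr₀ : L * r₀ = t s := mul_div_cancel₀ _ hL.ne'
    have hr₀0 : 0 ≤ r₀ := div_nonneg (ht0 s) hL.le
    have hr₀1 : r₀ ≤ 1 := (div_le_one hL).2 (htL s)
    have hlin : Continuous fun r : ℝ => L * r := continuous_const.mul continuous_id
    -- the strict constraints hold on a neighbourhood of `r₀`
    have hev : ∀ᶠ r in 𝓝 r₀, (∀ s', t s < t s' → L * r < t s') ∧ W * (L * r - t s) < δ ∧
        Torus.euclidDist (X s (L * r)) (X s (t s)) < δ := by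
      refine (Filter.eventually_all.2 fun s' => ?_).and (Filter.Eventually.and ?_ ?_)
      · by_cases hss : t s < t s'
        · have hc : Tendsto (fun r => L * r) (𝓝 r₀) (𝓝 (t s)) := by
            rw [← hLr₀]; exact hlin.tendsto r₀
          exact (hc.eventually (eventually_lt_nhds hss)).mono fun r hr _ => hr
        · exact Eventually.of_forall fun r h => absurd h hss
      · have hc : Tendsto (fun r => W * (L * r - t s)) (𝓝 r₀) (𝓝 (W * (L * r₀ - t s))) :=
          (by fun_prop : Continuous fun r => W * (L * r - t s)).tendsto r₀
        rw [hLr₀, sub_self, mul_zero] at hc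
        exact hc.eventually (eventually_lt_nhds hδ)
      · have hc : Tendsto (fun r => Torus.euclidDist (X s (L * r)) (X s (t s))) (𝓝 r₀)
            (𝓝 (Torus.euclidDist (X s (L * r₀)) (X s (t s)))) :=
          (continuous_torusDist_comp ((hX s).comp hlin) _).tendsto r₀
        rw [hLr₀, Torus.euclidDist_self] at hc
        exact hc.eventually (eventually_lt_nhds hδ)
    obtain ⟨η, hη, hball⟩ := Metric.eventually_nhds_iff.1 hev
    obtain ⟨q, hq₀, hq₁, hqη⟩ : ∃ q : ℚ, r₀ ≤ q ∧ (q : ℝ) ≤ 1 ∧ dist (q : ℝ) r₀ < η := by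
      rcases hr₀1.eq_or_lt with h1 | h1
      · exact ⟨1, by exact_mod_cast h1.le, by simp, by rw [Rat.cast_one, ← h1, dist_self]; exact hη⟩
      · obtain ⟨q, hq1, hq2⟩ := exists_rat_btwn (lt_min (lt_add_of_pos_right r₀ hη) h1)
        refine ⟨q, hq1.le, (hq2.trans_le (min_le_right _ _)).le, ?_⟩
        rw [Real.dist_eq, abs_of_nonneg (sub_nonneg.2 hq1.le)]
        linarith [hq2.trans_le (min_le_left _ _)]
    obtain ⟨hC1, hC2, hC3⟩ := hball hqη
    refine ⟨q, ⟨by exact_mod_cast hr₀0.trans hq₀, by exact_mod_cast hq₁⟩, ?_,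
      fun s' hs' => hC1 s' hs', hC2.le, hC3.le⟩
    rw [← hLr₀]
    exact mul_le_mul_of_nonneg_left hq₀ hL.le
  choose q hq using key
  refine ⟨q, fun s s' hss => ?_, fun s => (hq s).1, fun s => ⟨(hq s).2.1, (hq s).2.2.2⟩⟩
  have h1 : L * q s < t s' := (hq s).2.2.1 s' (ht hss)
  have h2 : t s' ≤ L * q s' := (hq s').2.1
  have h3 : ((q s : ℚ) : ℝ) < q s' := lt_of_mul_lt_mul_left (h1.trans_le h2) hL.le
  exact_mod_cast h3

/-- **From a raw anchored chain to a tight chain.** An anchored chain of `K` links through TRUE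
space-time points at real times `0 < τ 0 < ⋯ < τ K ≤ Tℓ`, with distinct particles and steps
`≤ ε + w' Δτ`, yields a tight chain (`IsTightChain`): round the times up to grid times with
slack `ε / (3 (K + 1))` per endpoint (`exists_grid_rounding`, positions are continuous). -/
theorem isTightChain_of_rawChain {σ T w' : ℝ} {N K : ℕ} (Φ : Flow σ N) {z : Phase N}
    (hz : z ∈ Φ.good) {i : Fin (N + 1)} (hε : 0 < hsDiameter σ N) (hw' : 0 ≤ w')
    (j : Fin (K + 1) → Fin (N + 1)) (τ : Fin (K + 1) → ℝ) (hj : Injective j)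
    (hji : j (Fin.last K) = i) (hτ : StrictMono τ) (hτ0 : ∀ s, 0 < τ s)
    (hτL : ∀ s, τ s ≤ T * ell N)
    (hlink : ∀ m : Fin K, Torus.euclidDist (Φ.flow (τ m.succ) z (j m.succ)).1
      (Φ.flow (τ m.castSucc) z (j m.castSucc)).1 ≤ hsDiameter σ N + w' * (τ m.succ - τ m.castSucc)) :
    IsTightChain σ T N Φ w' K z i := by
  set L : ℝ := T * ell N with hLdef
  set ε : ℝ := hsDiameter σ N with hεdef
  have hL0 : 0 < L := (hτ0 0).trans_le (hτL 0)
  have hδ : 0 < ε / (3 * (K + 1)) := by positivity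
  obtain ⟨q, hqmono, hq01, hq⟩ := exists_grid_rounding (W := w') hL0 hδ hτ (fun s => (hτ0 s).le)
    hτL (X := fun s r => (Φ.flow r z (j s)).1) (fun s => (Φ.isTrajectory z hz).pos_continuous (j s))
  refine ⟨j, q, hj, hji, hqmono.monotone, hq01, fun m => ?_⟩
  obtain ⟨hq1, -, hq3⟩ := hq m.succ
  obtain ⟨-, hq2', hq3'⟩ := hq m.castSucc
  set P : Fin (K + 1) → ℝ → T3 := fun s r => (Φ.flow r z (j s)).1 with hPdef
  have htri1 := torusDist_triangle (P m.succ (L * q m.succ)) (P m.succ (τ m.succ))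
    (P m.castSucc (L * q m.castSucc))
  have htri2 := torusDist_triangle (P m.succ (τ m.succ)) (P m.castSucc (τ m.castSucc))
    (P m.castSucc (L * q m.castSucc))
  rw [Torus.euclidDist_comm (P m.castSucc (τ m.castSucc)) (P m.castSucc (L * q m.castSucc))] at htri2
  have hqq : L * q m.castSucc ≤ L * q m.succ := by
    have := hqmono.monotone m.castSucc_lt_succ.le
    exact mul_le_mul_of_nonneg_left (by exact_mod_cast this) hL0.le
  have htime : w' * (τ m.succ - τ m.castSucc) ≤
      w' * (L * q m.succ - L * q m.castSucc) + ε / (3 * (K + 1)) := by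
    have h1 : w' * (τ m.succ - τ m.castSucc) ≤ w' * (L * q m.succ - τ m.castSucc) :=
      mul_le_mul_of_nonneg_left (by linarith) hw'
    have h2 : w' * (L * q m.succ - τ m.castSucc) =
        w' * (L * q m.succ - L * q m.castSucc) + w' * (L * q m.castSucc - τ m.castSucc) := by ring
    linarith
  have hK : (3 : ℝ) * (ε / (3 * (K + 1))) = ε * (1 / (K + 1)) := by
    field_simp
  have hl := hlink m
  show Torus.euclidDist (P m.succ (L * q m.succ)) (P m.castSucc (L * q m.castSucc)) ≤
    ε * (1 + 1 / (K + 1)) + w' * (L * (q m.succ - q m.castSucc))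
  rw [mul_sub L, mul_add ε, mul_one]
  linarith [htri1, htri2, hq3, hq3', hl, htime, hK]

/-! ## The raw chain of a cold bad particle on the good set -/

/-- **The first-infection lineage as a raw chain.** On the good set, a bad particle `i` that is
neither hot in its halo nor forecast-hot is the endpoint of an anchored chain of `K` links through
TRUE space-time points: distinct particles `j 0, …, j K = i`, real times
`0 < τ 0 < ⋯ < τ K ≤ Tℓ`, steps `≤ ε + (w + ‖u₀‖) Δτ` (the lineage of
`CoveringSetting.exists_lineage` for the setting formed by the true orbit and the forecast world
of `i`, read backwards). -/
theorem exists_rawChain_of_good {σ T R u w D : ℝ} {u₀ : V3} {N K : ℕ} (Φ : Flow σ N)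
    (Ψ : ClusterFlows σ N) (hσ : 0 < σ) (hT : 0 ≤ T) (hu : 0 < u) (huw : u ≤ w)
    (hD : (u + ‖u₀‖) * T + 2 * σ ≤ D) (hR : ((K : ℝ) + 2) * σ + (u + w + 2 * ‖u₀‖) * T ≤ R)
    {z : Phase N} (hz : z ∈ Φ.good) {i : Fin (N + 1)}
    (hy : Config.restrictTo (rangeCluster G3 (R * ell N) z i) z ∈
      (Ψ (rangeCluster G3 (R * ell N) z i).card).good)
    (hbad : IsBad σ T R N Φ Ψ z i) (hhot : ¬ IsHot σ T N Φ u₀ u (R + D) z i)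
    (hfh : ¬ IsForecastHot σ T R N Ψ u₀ w z i) :
    ∃ (j : Fin (K + 1) → Fin (N + 1)) (τ : Fin (K + 1) → ℝ), Injective j ∧ j (Fin.last K) = i ∧
      StrictMono τ ∧ (∀ s, 0 < τ s ∧ τ s ≤ T * ell N) ∧
      ∀ m : Fin K, Torus.euclidDist (Φ.flow (τ m.succ) z (j m.succ)).1
          (Φ.flow (τ m.castSucc) z (j m.castSucc)).1 ≤
        hsDiameter σ N + (w + ‖u₀‖) * (τ m.succ - τ m.castSucc) := by
  -- names
  set S := rangeCluster G3 (R * ell N) z i with hSdef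
  set L : ℝ := T * ell N with hLdef
  set ε : ℝ := hsDiameter σ N with hεdef
  have hℓ : 0 < ell N := Real.rpow_pos_of_pos (by positivity) _
  have hεℓ : ε = σ * ell N := rfl
  have hε0 : 0 < ε := by rw [hεℓ]; exact mul_pos hσ hℓ
  have hU0 : 0 ≤ u + ‖u₀‖ := by positivity
  set Γ : ℝ → Phase N := fun t => Φ.flow t z with hΓdef
  set F : ℝ → Config S.card (Fin 3) T3 := forecastWorld σ R N Ψ z i with hFdef
  set e : Fin S.card → Fin (N + 1) := fun m => S.orderEmbOfFin rfl m with hedef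
  set m₀ : Fin S.card := clusterIndex S i (self_mem_rangeCluster G3 (R * ell N) z i) with hm₀def
  have hem₀ : e m₀ = i := orderEmbOfFin_clusterIndex S i _
  have hΓ : IsHardSphereTrajectory G3 ε (N + 1) Γ := Φ.isTrajectory z hz
  have hF : IsHardSphereTrajectory G3 ε S.card F := (Ψ S.card).isTrajectory _ hy
  have hΓ0 : Γ 0 = z := Φ.flow_zero z hz
  have hF0 : F 0 = Config.restrictTo S z := (Ψ S.card).flow_zero _ hy
  have h0 : ∀ m, F 0 m = Γ 0 (e m) := fun m => by rw [hF0, hΓ0]; rfl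
  have he : Injective e := (S.orderEmbOfFin rfl).injective
  have heS : ∀ m, e m ∈ S := fun m => S.orderEmbOfFin_mem rfl m
  have hR0 : 0 ≤ R * ell N := by
    have h1 : 0 ≤ (u + w + 2 * ‖u₀‖) * T := mul_nonneg (by linarith [norm_nonneg u₀]) hT
    have h2 : 0 ≤ ((K : ℝ) + 2) * σ := by positivity
    exact mul_nonneg (by linarith) hℓ.le
  -- caps: from grid times to all times
  have hO : IsOpen {p : T3 × V3 | Torus.euclidDist p.1 (z i).1 < (R + D) * ell N} := by
    have hc : Continuous fun p : T3 × V3 => Torus.euclidDist p.1 (z i).1 := by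
      have h := (Torus.continuous_euclidDist (d := Fin 3)).comp
        ((continuous_fst (X := T3) (Y := V3)).prodMk (continuous_const (y := (z i).1)))
      simpa only [Function.comp_def] using h
    exact isOpen_lt hc continuous_const
  have hCu : IsClosed {p : T3 × V3 | ‖p.2 - u₀‖ ≤ u} := isClosed_le (by fun_prop) continuous_const
  have hCw : IsClosed {p : T3 × V3 | ‖p.2 - u₀‖ ≤ w} := isClosed_le (by fun_prop) continuous_const
  have hcapΓ : ∀ c, ∀ t ∈ Icc 0 L, Torus.euclidDist (Γ t c).1 (Γ 0 (e m₀)).1 < (R + D) * ell N →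
      ‖(Γ t c).2‖ ≤ u + ‖u₀‖ := by
    intro c t ht hin
    rw [hem₀, hΓ0] at hin
    have hgrid : ∀ q : ℚ, 0 ≤ q → q ≤ 1 →
        Γ (L * q) c ∈ {p : T3 × V3 | Torus.euclidDist p.1 (z i).1 < (R + D) * ell N} →
        Γ (L * q) c ∈ {p : T3 × V3 | ‖p.2 - u₀‖ ≤ u} := by
      intro q hq0 hq1 hqin
      by_contra hfast
      exact hhot ⟨c, q, hq0, hq1, not_le.1 hfast, hqin⟩
    have hle : ‖(Γ t c).2 - u₀‖ ≤ u := mem_of_grid hΓ c hO hCu hgrid t ht hin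
    calc ‖(Γ t c).2‖ = ‖(Γ t c).2 - u₀ + u₀‖ := by rw [sub_add_cancel]
      _ ≤ ‖(Γ t c).2 - u₀‖ + ‖u₀‖ := norm_add_le _ _
      _ ≤ u + ‖u₀‖ := add_le_add hle le_rfl
  have hcapF : ∀ m, ∀ t ∈ Icc 0 L, ‖(F t m).2‖ ≤ w + ‖u₀‖ := by
    intro m t ht
    have hgrid : ∀ q : ℚ, 0 ≤ q → q ≤ 1 → F (L * q) m ∈ (Set.univ : Set (T3 × V3)) →
        F (L * q) m ∈ {p : T3 × V3 | ‖p.2 - u₀‖ ≤ w} := by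
      intro q hq0 hq1 _
      by_contra hfast
      exact hfh ⟨m, q, hq0, hq1, not_le.1 hfast⟩
    have hle : ‖(F t m).2 - u₀‖ ≤ w := mem_of_grid hF m isOpen_univ hCw hgrid t ht (mem_univ _)
    calc ‖(F t m).2‖ = ‖(F t m).2 - u₀ + u₀‖ := by rw [sub_add_cancel]
      _ ≤ ‖(F t m).2 - u₀‖ + ‖u₀‖ := norm_add_le _ _
      _ ≤ w + ‖u₀‖ := add_le_add hle le_rfl
  have hmargin : R * ell N + (u + ‖u₀‖) * L < (R + D) * ell N := by
    have h1 : (u + ‖u₀‖) * T < D := by linarith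
    have key : (R + D) * ell N - (R * ell N + (u + ‖u₀‖) * L) = (D - (u + ‖u₀‖) * T) * ell N := by
      rw [hLdef]; ring
    rw [← sub_pos, key]
    exact mul_pos (sub_pos.2 h1) hℓ
  have hmem : ∀ m, Torus.euclidDist (Γ 0 (e m)).1 (Γ 0 (e m₀)).1 ≤ R * ell N := by
    intro m
    rw [hem₀, hΓ0]
    rcases mem_rangeCluster_torus.1 (heS m) with h | h
    · rw [h, Torus.euclidDist_self]; exact hR0
    · rwa [Torus.euclidDist_comm]
  have hout : ∀ c, c ∉ Set.range e → R * ell N < Torus.euclidDist (Γ 0 c).1 (Γ 0 (e m₀)).1 := by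
    intro c hc
    rw [hem₀, hΓ0]
    have h : c ∉ S := fun hcS => hc ⟨clusterIndex S c hcS, orderEmbOfFin_clusterIndex S c hcS⟩
    rw [hSdef, mem_rangeCluster_torus, not_or, not_le] at h
    rw [Torus.euclidDist_comm]
    exact h.2
  -- badness of `i` = infection of `m₀`
  have hloc : ∀ t, localClusterState Ψ (R * ell N) t z i = F t m₀ := fun t =>
    clusterStateIn_of_mem_good Ψ _ t hy
  have hbad' : ∃ t ∈ Icc 0 L, Γ t (e m₀) ≠ F t m₀ := by
    obtain ⟨t, ht, hne⟩ := hbad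
    refine ⟨t, ht, ?_⟩
    rw [hem₀, ← hloc t]
    exact hne
  have hspan : ((K : ℝ) + 2) * ε + (u + ‖u₀‖ + (w + ‖u₀‖)) * L ≤ R * ell N := by
    have key : R * ell N - (((K : ℝ) + 2) * ε + (u + ‖u₀‖ + (w + ‖u₀‖)) * L) =
        (R - (((K : ℝ) + 2) * σ + (u + w + 2 * ‖u₀‖) * T)) * ell N := by
      rw [hεℓ, hLdef]; ring
    rw [← sub_nonneg, key]
    exact mul_nonneg (sub_nonneg.2 hR) hℓ.le
  -- the lineage of `K` links hanging from `m₀`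
  have hlin : ∀ n ≤ K, ∃ a : ℕ → Fin S.card, a ∈ lineages ε (w + ‖u₀‖) Γ F e m₀ n :=
    CoveringSetting.exists_lineage
      { ε := ε, L := L, U := u + ‖u₀‖, W := w + ‖u₀‖, ρ := R * ell N, ρ' := (R + D) * ell N,
        Γ := Γ, F := F, e := e, m₀ := m₀, hΓ := hΓ, hF := hF, h0 := h0, he := he, hε := hε0,
        hU := hU0, hUW := by linarith, hmargin := hmargin, hmem := hmem, hout := hout,
        hcapΓ := hcapΓ, hcapF := hcapF } hspan hbad'
  obtain ⟨a, ha⟩ := hlin K le_rfl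
  have hL₀ : infTime Γ F e m₀ ≤ L := infTime_le_of_bad hbad'
  -- reversed: chain members `a (K - s)` with increasing infection times
  refine ⟨fun s => e (a (K - s)), fun s => infTime Γ F e (a (K - s)), ?_, ?_, ?_, fun s => ⟨?_, ?_⟩,
    fun m => ?_⟩
  · intro s s' hss
    have h2 : K - (s : ℕ) = K - s' := Lineage.injOn ha (Nat.sub_le _ _) (Nat.sub_le _ _) (he hss)
    have hs := s.2
    have hs' := s'.2
    exact Fin.ext (by omega)
  · show e (a (K - K)) = i
    rw [Nat.sub_self, ha.1, hem₀]
  · intro s s' hss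
    have hss' : (s : ℕ) < s' := Fin.lt_def.1 hss
    have hs' := s'.2
    exact Lineage.infTime_lt ha (by omega) (Nat.sub_le _ _)
  · exact infTime_pos hΓ hF h0 (ha.2.1 (K - s) (Nat.sub_le _ _))
  · exact (Lineage.infTime_le_head ha (Nat.sub_le _ _)).trans hL₀
  · have hm : (m : ℕ) < K := m.2
    have h := (ha.2.2 (K - (m + 1)) (by omega)).2
    have hidx : K - (m + 1) + 1 = K - m := by omega
    rw [hidx] at h
    simpa only [Fin.val_succ, Fin.val_castSucc] using h

/-! ## The anchored covering -/

/-- **The anchored covering, pointwise on the good set.** If `z` is good for the true flow and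
the range-`Rℓ` cluster of `i` restricts to a good datum of its cluster flow, and `i` is bad,
not hot in its halo and not forecast-hot, then a tight anchored chain of `K` links of absolute
speed `w + ‖u₀‖` ends at `i`. -/
theorem anchoredCovering_of_good {σ T R u w D : ℝ} {u₀ : V3} {N K : ℕ} (Φ : Flow σ N)
    (Ψ : ClusterFlows σ N) (hσ : 0 < σ) (hT : 0 ≤ T) (hu : 0 < u) (huw : u ≤ w)
    (hD : (u + ‖u₀‖) * T + 2 * σ ≤ D) (hR : ((K : ℝ) + 2) * σ + (u + w + 2 * ‖u₀‖) * T ≤ R)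
    {z : Phase N} (hz : z ∈ Φ.good) {i : Fin (N + 1)}
    (hy : Config.restrictTo (rangeCluster G3 (R * ell N) z i) z ∈
      (Ψ (rangeCluster G3 (R * ell N) z i).card).good)
    (hbad : IsBad σ T R N Φ Ψ z i) (hhot : ¬ IsHot σ T N Φ u₀ u (R + D) z i)
    (hfh : ¬ IsForecastHot σ T R N Ψ u₀ w z i) : IsTightChain σ T N Φ (w + ‖u₀‖) K z i := by
  obtain ⟨j, τ, hj, hji, hτ, hτb, hlink⟩ :=
    exists_rawChain_of_good Φ Ψ hσ hT hu huw hD hR hz hy hbad hhot hfh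
  have hℓ : 0 < ell N := Real.rpow_pos_of_pos (by positivity) _
  exact isTightChain_of_rawChain Φ hz (mul_pos hσ hℓ) (by linarith [norm_nonneg u₀]) j τ hj hji hτ
    (fun s => (hτb s).1) (fun s => (hτb s).2) hlink

/-- **Registered stub STUB 3 `stub_anchoredCovering`** of the line `true-anchored-infection`
(crux stmt-AtomisticToContinuum-13916): the anchored covering `AnchoredCovering` — for
`G_N`-a.e. datum and every particle `i`, a cold-sector bad particle `i` (bad at range `R`, no
`u`-hot true particle in its `(R + D)ℓ`-halo, no `w`-hot forecast particle, `u ≤ w`) is the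
endpoint of a tight anchored chain of `K` links of absolute speed `w + ‖u₀‖`, whenever
`(K + 2)σ + (u + w + 2‖u₀‖)T ≤ R` and `(u + ‖u₀‖)T + 2σ ≤ D`. Off the null set
`Φ.goodᶜ ∪ ⋃_S {z | restrictTo S z ∉ (Ψ |S|).good}` (`G_N ≪ Liouville`,
`ae_restrictTo_mem_good`) this is `anchoredCovering_of_good`. -/
theorem stub_anchoredCovering : AnchoredCovering := by
  intro σ a θ u₀ N Φ Ψ T R u w D K hσ _ _ _ hT hu huw hD hR
  have hac : gibbs σ a θ u₀ N Φ ≪ liouville G3 (N + 1) (hsDiameter σ N) := by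
    unfold gibbs localGibbsLaw
    rw [particleLaw_eq]
    exact withDensity_absolutelyContinuous _ _
  have h1 : ∀ᵐ z ∂(liouville G3 (N + 1) (hsDiameter σ N)), z ∈ Φ.good := Φ.ae_mem_good
  have h2 : ∀ᵐ z ∂(liouville G3 (N + 1) (hsDiameter σ N)), ∀ S : Finset (Fin (N + 1)),
      Config.restrictTo S z ∈ (Ψ S.card).good :=
    ae_all_iff.2 fun S => ae_restrictTo_mem_good Ψ S
  filter_upwards [hac.ae_le h1, hac.ae_le h2] with z hz hS i hbad hhot hfh
  exact anchoredCovering_of_good Φ Ψ hσ hT hu huw hD hR hz (hS _) hbad hhot hfh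

end

end Summit.AtomisticToContinuum.HydrodynamicLimit.Theorems.TrueAnchoredInfection
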